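import Literature.Probability.LatticeModels.PlaneRotatorLiebCriterion
import Literature.Probability.LatticeModels.PlaneRotatorPathFloor
import Mathlib.Combinatorics.SimpleGraph.Walk.Counting
import Mathlib.Combinatorics.SimpleGraph.Paths
import HarnessLib

/-!
# Fisher's self-avoiding-walk bound for the plane rotator with the two-spin value `u = I₁/I₀`

Topic `Literature/Probability/LatticeModels`. For the classical plane-rotator (XY) model with ferromagnetic pair
couplings `J ≥ 0` on the ordered pairs of a finite vertex set `V` (the tree's `PlaneRotator.twoPoint J a c =
⟨cos(θ_a − θ_c)⟩_J`, weight `exp(∑_{(x,y)} J(x,y) cos(θ_y − θ_x))`, `PlaneRotatorGinibreComparison.lean`), the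
two-point function is bounded by the generating function of SELF-AVOIDING WALKS weighted by the two-spin
expectation `u(K_{xy}) = I₁(K_{xy})/I₀(K_{xy})` of the merged bond coupling `K_{xy} = J(x,y) + J(y,x)`:

* `PlaneRotator.twoPoint_le_sum_paths_besselRatio` — for every simple graph `G` on `V` carrying the support of `J`
  (`J(x,y) ≠ 0`, `x ≠ y` ⇒ `x ∼ y`) and all `a, c`:
  `⟨cos(θ_a − θ_c)⟩_J ≤ ∑_{ω : G-path a → c} ∏_{k < |ω|} u(K_{ω_k ω_{k+1}})`,
  the sum over the self-avoiding walks (Mathlib `SimpleGraph.Walk.IsPath`, listed by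
  `SimpleGraph.finsetWalkLengthLT (card V)`) from `a` to `c`.

This is the exact analogue of Fisher's Ising bound (M. E. Fisher, Phys. Rev. 162 (1967) 480; tree
`IsingSAWBoundGraph.isingTwoPoint_free_le_pathSum`, `tanh β` per bond) with `tanh β ↦ u(K)`; since `u(K) < tanh(K/2)`
it dominates the chain "Aizenman–Simon halving + Ising–Fisher" used so far for certificate-free high-temperature
windows of the layered XY comparison model. PROOF (E. H. Lieb, Comm. Math. Phys. 77 (1980) 127, p. 133: the
integer-current / character expansion "one would have to deal with directed graphs"): by the character expansion
(`integral_reChar_mul_ginibreWeight`, `GinibreCharacterExpansion.lean`)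
`Z⟨cos(θ_a − θ_c)⟩ = ∑_{n : div n = δ_a − δ_c} W(n)`, `Z = ∑_{div n = 0} W(n)`, `W(n) = ∏_p I_{n_p}(J_p) ≥ 0`, the
currents `n ∈ ℤ^{V×V}` flowing `n_p` units from `p.1` to `p.2`; (1) a current with `div n = δ_a − δ_c` has a walk
`a → c` along arcs carrying positive current in the direction of travel (discrete divergence theorem over the set of
vertices reachable from `a`, `sum_outflow_eq`); (2) a shortest such walk is vertex-self-avoiding; (3) removing the
unit flow along it lands in `{div = 0}` and costs at most `∏ u(K_b)` by the monotonicity of `m ↦ I_m/I_{m−1}`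
(Turán's inequality `besselI_mul_besselI_add_two_le_sq`); (4) for a fixed walk the removal is a translation of
`ℤ^{V×V}`, hence injective; sum over the walks. Couplings are first merged per unordered pair and oriented along an
enumeration of `V` (`twoPoint_congr_offDiag`, `twoPoint_eq_of_symm`), which is what turns `u(J(x,y)) + u(J(y,x))`
into the sharper `u(J(x,y) + J(y,x))`.

References: M. E. Fisher, Phys. Rev. 162 (1967) 480 [Fisher1967]; E. H. Lieb, Comm. Math. Phys. 77 (1980) 127,
Theorem 4 and p. 133 [Lieb1980]; N. Madras, G. Slade, *The Self-Avoiding Walk* (1993), §1.2 [MadrasSlade1993].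
Cell use (`pub/hubbard-tc`, ASSUMPTIONS §0/§1 key K4-a, memo `FISHER-SAW-PLANE-ROTATOR.md`): classical comparison
model only; no `T_c` object, nothing on the ordered side.
-/

noncomputable section

open MeasureTheory Filter Finset
open scoped Topology BigOperators

namespace Literature.Probability.LatticeModels

namespace PlaneRotator

/-! ### §1 Bessel ratios: `I_{k+1}/I_k ≤ I₁/I₀` -/

section Bessel

/-- **The ratios `I_{k+1}(x)/I_k(x)` are non-increasing in `k`**, division-free form:
`I_{k+1}(x)·I₀(x) ≤ I_k(x)·I₁(x)` for `x ≥ 0` (induction on `k` with Turán's inequality `I_k I_{k+2} ≤ I_{k+1}²`).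
[cite: Lieb1980, p. 133 (I_m(β) weights of the directed-graph expansion)] -/
theorem besselI_succ_mul_besselI_zero_le {x : ℝ} (hx : 0 ≤ x) (k : ℕ) :
    besselI ((k + 1 : ℕ) : ℤ) x * besselI 0 x ≤ besselI (k : ℤ) x * besselI 1 x := by
  induction k with
  | zero => simp only [Nat.zero_add, Nat.cast_one, Nat.cast_zero]; rw [mul_comm]
  | succ k ih =>
    have hT := besselI_mul_besselI_add_two_le_sq k x
    rcases eq_or_lt_of_le hx with hx0 | hx'
    · rw [← hx0, besselI_zero_right ((k + 1 + 1 : ℕ) : ℤ), besselI_zero_right ((k + 1 : ℕ) : ℤ)]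
      have h1 : ((k + 1 + 1 : ℕ) : ℤ) ≠ 0 := by omega
      have h2 : ((k + 1 : ℕ) : ℤ) ≠ 0 := by omega
      rw [if_neg h1, if_neg h2, zero_mul, zero_mul]
    · have hpos : 0 < besselI (k : ℤ) x := besselI_pos hx' _
      have h0 : 0 ≤ besselI 0 x := besselI_nonneg hx 0
      have hk1 : 0 ≤ besselI ((k + 1 : ℕ) : ℤ) x := besselI_nonneg hx _
      have h1 : besselI ((k + 1 + 1 : ℕ) : ℤ) x * besselI 0 x * besselI (k : ℤ) x ≤
          besselI ((k + 1 : ℕ) : ℤ) x * besselI 1 x * besselI (k : ℤ) x :=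
        calc besselI ((k + 1 + 1 : ℕ) : ℤ) x * besselI 0 x * besselI (k : ℤ) x
            = (besselI (k : ℤ) x * besselI ((k + 2 : ℕ) : ℤ) x) * besselI 0 x := by
              rw [show k + 1 + 1 = k + 2 from rfl]; ring
          _ ≤ besselI ((k + 1 : ℕ) : ℤ) x ^ 2 * besselI 0 x := mul_le_mul_of_nonneg_right hT h0
          _ = besselI ((k + 1 : ℕ) : ℤ) x * (besselI ((k + 1 : ℕ) : ℤ) x * besselI 0 x) := by ring
          _ ≤ besselI ((k + 1 : ℕ) : ℤ) x * (besselI (k : ℤ) x * besselI 1 x) :=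
              mul_le_mul_of_nonneg_left ih hk1
          _ = besselI ((k + 1 : ℕ) : ℤ) x * besselI 1 x * besselI (k : ℤ) x := by ring
      exact le_of_mul_le_mul_right h1 hpos

/-- Unit extraction costs at most the two-spin value: if `|m| = |m'| + 1` then
`I_m(x) ≤ u(x)·I_{m'}(x)`, `u = I₁/I₀`, `x ≥ 0`. [cite: Lieb1980, p. 133 (I_m(β) weights of the directed-graph expansion)] -/
theorem besselI_le_besselRatio_mul {x : ℝ} (hx : 0 ≤ x) {m m' : ℤ} (h : m'.natAbs + 1 = m.natAbs) :
    besselI m x ≤ besselI 1 x / besselI 0 x * besselI m' x := by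
  have h0 : 0 < besselI 0 x := by
    rcases eq_or_lt_of_le hx with hx0 | hx'
    · rw [← hx0, besselI_zero_right, if_pos rfl]; exact one_pos
    · exact besselI_pos hx' 0
  rw [div_mul_eq_mul_div, le_div_iff₀ h0]
  have hm : besselI m x = besselI ((m'.natAbs + 1 : ℕ) : ℤ) x := by
    rcases Int.natAbs_eq m with e | e
    · rw [← h] at e; conv_lhs => rw [e]
    · rw [← h] at e; conv_lhs => rw [e, besselI_neg_index]
  have hm' : besselI m' x = besselI (m'.natAbs : ℤ) x := by
    rcases Int.natAbs_eq m' with e | e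
    · conv_lhs => rw [e]
    · conv_lhs => rw [e, besselI_neg_index]
  rw [hm, hm', mul_comm (besselI 1 x)]
  exact besselI_succ_mul_besselI_zero_le hx _

end Bessel

/-! ### §2 Integer currents on ordered pairs: divergence, positive walks, shortest walks are self-avoiding -/

section Flow

variable {V : Type} [Fintype V] [DecidableEq V]

/-- The net outflow `∑_p n_p ([x = p.1] − [x = p.2])` of an integer current `n ∈ ℤ^{V×V}` at the vertex `x`
(`n_p` units flow from `p.1` to `p.2`): minus Lieb's valence "arrows in minus arrows out" of the directed multigraph of
the expansion (private plumbing). [cite: Lieb1980, p. 133 (directed graphs; valences of the expansion)] -/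
private def outflow (n : V × V → ℤ) (x : V) : ℤ :=
  ∑ p : V × V, n p * ((if x = p.1 then 1 else 0) - (if x = p.2 then 1 else 0))

/-- The oriented bond used by the `k`-th step of the vertex sequence `v` (oriented along the ranking `r`); private
plumbing. [folklore] -/
private def sbond (r : V → ℕ) (v : ℕ → V) (k : ℕ) : V × V :=
  if r (v k) < r (v (k + 1)) then (v k, v (k + 1)) else (v (k + 1), v k)

/-- The sign with which the `k`-th step of `v` traverses its oriented bond; private plumbing. [folklore] -/
private def ssign (r : V → ℕ) (v : ℕ → V) (k : ℕ) : ℤ :=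
  if r (v k) < r (v (k + 1)) then 1 else -1

/-- The unit flow along the first `L` steps of the vertex sequence `v` (one unit on each traversed bond, with the sign
of traversal); private plumbing. [folklore] -/
private def sflow (r : V → ℕ) (L : ℕ) (v : ℕ → V) (q : V × V) : ℤ :=
  ∑ k ∈ Finset.range L, if q = sbond r v k then ssign r v k else 0

/-- The outflow is additive: `div (n − m) = div n − div m`. [folklore] -/
private theorem outflow_sub (n m : V × V → ℤ) (x : V) : outflow (n - m) x = outflow n x - outflow m x := by
  simp only [outflow, Pi.sub_apply, sub_mul, Finset.sum_sub_distrib]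

/-- **Discrete divergence theorem**: the total outflow of a vertex set `S` is the flux through its boundary,
`∑_{x ∈ S} div n (x) = ∑_p n_p ([p.1 ∈ S] − [p.2 ∈ S])`. [folklore] -/
private theorem sum_outflow_eq (n : V × V → ℤ) (S : Finset V) :
    ∑ x ∈ S, outflow n x = ∑ p : V × V, n p * ((if p.1 ∈ S then 1 else 0) - (if p.2 ∈ S then 1 else 0)) := by
  unfold outflow
  rw [Finset.sum_comm]
  refine Finset.sum_congr rfl fun p _ => ?_
  rw [← Finset.mul_sum, Finset.sum_sub_distrib, Finset.sum_ite_eq' S p.1, Finset.sum_ite_eq' S p.2]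

/-- **Flow paths.** A current with `div n = δ_s − δ_t`, `s ≠ t`, admits a walk from `s` to `t` each of whose steps
`x → y` carries positive current in the direction of travel (`n(x,y) ≥ 1` or `n(y,x) ≤ −1`): otherwise the set `S`
of vertices so reachable from `s` misses `t`, has total outflow `1`, and no arc leaving `S` carries positive flux.
[cite: Lieb1980, p. 133 (directed graphs of the expansion)] -/
private theorem exists_posWalk {n : V × V → ℤ} {s t : V}
    (hdiv : ∀ x, outflow n x = (if x = s then 1 else 0) - (if x = t then 1 else 0)) :
    ∃ L : ℕ, ∃ v : ℕ → V, v 0 = s ∧ v L = t ∧ ∀ k < L, 0 < n (v k, v (k + 1)) ∨ n (v (k + 1), v k) < 0 := by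
  classical
  by_contra hcon
  set S : Finset V := Finset.univ.filter (fun x => ∃ L : ℕ, ∃ v : ℕ → V, v 0 = s ∧ v L = x ∧
    ∀ k < L, 0 < n (v k, v (k + 1)) ∨ n (v (k + 1), v k) < 0) with hS
  have hsS : s ∈ S := by
    rw [hS, Finset.mem_filter]
    exact ⟨Finset.mem_univ _, 0, fun _ => s, rfl, rfl, fun k hk => absurd hk (Nat.not_lt_zero _)⟩
  have htS : t ∉ S := fun ht => hcon (by rw [hS, Finset.mem_filter] at ht; exact ht.2)
  have hstep : ∀ x ∈ S, ∀ y, (0 < n (x, y) ∨ n (y, x) < 0) → y ∈ S := by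
    intro x hx y hxy
    rw [hS, Finset.mem_filter] at hx ⊢
    obtain ⟨-, L, v, hv0, hvL, hv⟩ := hx
    refine ⟨Finset.mem_univ _, L + 1, fun k => if k ≤ L then v k else y, ?_, ?_, fun k hk => ?_⟩
    · dsimp only
      rw [if_pos (Nat.zero_le _), hv0]
    · dsimp only
      rw [if_neg (show ¬ (L + 1 ≤ L) by omega)]
    · dsimp only
      by_cases hk' : k < L
      · rw [if_pos hk'.le, if_pos (show k + 1 ≤ L by omega)]; exact hv k hk'
      · have hkL : k = L := by omega
        rw [hkL, if_pos le_rfl, if_neg (show ¬ (L + 1 ≤ L) by omega), hvL]; exact hxy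
  have hsum : ∑ x ∈ S, outflow n x = 1 := by
    calc ∑ x ∈ S, outflow n x = ∑ x ∈ S, ((if x = s then (1 : ℤ) else 0) - (if x = t then 1 else 0)) :=
          Finset.sum_congr rfl fun x _ => hdiv x
      _ = 1 := by
          rw [Finset.sum_sub_distrib, Finset.sum_ite_eq' S s, Finset.sum_ite_eq' S t, if_pos hsS, if_neg htS,
            sub_zero]
  have hle : ∑ x ∈ S, outflow n x ≤ 0 := by
    rw [sum_outflow_eq]
    refine Finset.sum_nonpos fun p _ => ?_
    by_cases h1 : p.1 ∈ S
    · by_cases h2 : p.2 ∈ S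
      · rw [if_pos h1, if_pos h2, sub_self, mul_zero]
      · rw [if_pos h1, if_neg h2, sub_zero, mul_one]
        by_contra hp
        exact h2 (hstep p.1 h1 p.2 (Or.inl (not_le.1 hp)))
    · by_cases h2 : p.2 ∈ S
      · rw [if_neg h1, if_pos h2, zero_sub, mul_neg, mul_one, neg_nonpos]
        by_contra hp
        exact h1 (hstep p.2 h2 p.1 (Or.inr (not_le.1 hp)))
      · rw [if_neg h1, if_neg h2, sub_self, mul_zero]
  omega

omit [Fintype V] [DecidableEq V] in
/-- **Excision.** A positive walk `s → t` of length `L` visiting a vertex twice (`v i = v j`, `i < j ≤ L`) can be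
shortened to a positive walk of length `L − (j − i)`. [cite: MadrasSlade1993, §1.2 (self-avoiding walks)] -/
private theorem posWalk_shorten {n : V × V → ℤ} {s t : V} {L : ℕ} {v : ℕ → V} (hv0 : v 0 = s) (hvL : v L = t)
    (hv : ∀ k < L, 0 < n (v k, v (k + 1)) ∨ n (v (k + 1), v k) < 0) {i j : ℕ} (hij : i < j) (hjL : j ≤ L)
    (heq : v i = v j) :
    ∃ w : ℕ → V, w 0 = s ∧ w (L - (j - i)) = t ∧
      ∀ k < L - (j - i), 0 < n (w k, w (k + 1)) ∨ n (w (k + 1), w k) < 0 := by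
  refine ⟨fun k => if k ≤ i then v k else v (k + (j - i)), ?_, ?_, fun k hk => ?_⟩
  · show (if 0 ≤ i then v 0 else v (0 + (j - i))) = s
    rw [if_pos (Nat.zero_le _), hv0]
  · show (if L - (j - i) ≤ i then v (L - (j - i)) else v (L - (j - i) + (j - i))) = t
    by_cases h : L - (j - i) ≤ i
    · have hLj : L = j := by omega
      have hidx : L - (j - i) = i := by omega
      rw [if_pos h, hidx, heq, ← hLj, hvL]
    · rw [if_neg h, show L - (j - i) + (j - i) = L by omega, hvL]
  · show 0 < n ((if k ≤ i then v k else v (k + (j - i))), (if k + 1 ≤ i then v (k + 1) else v (k + 1 + (j - i)))) ∨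
      n ((if k + 1 ≤ i then v (k + 1) else v (k + 1 + (j - i))), (if k ≤ i then v k else v (k + (j - i)))) < 0
    by_cases hk1 : k + 1 ≤ i
    · rw [if_pos (by omega : k ≤ i), if_pos hk1]; exact hv k (by omega)
    · by_cases hk2 : k ≤ i
      · have hki : k = i := by omega
        rw [if_pos hk2, if_neg hk1, show k + 1 + (j - i) = j + 1 by omega, hki, heq]
        exact hv j (by omega)
      · rw [if_neg hk2, if_neg hk1, show k + 1 + (j - i) = k + (j - i) + 1 by omega]
        exact hv (k + (j - i)) (by omega)

omit [Fintype V] [DecidableEq V] in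
/-- **A shortest positive walk is self-avoiding.** [cite: MadrasSlade1993, §1.2 (self-avoiding walks)] -/
private theorem exists_injective_posWalk {n : V × V → ℤ} {s t : V}
    (h : ∃ L : ℕ, ∃ v : ℕ → V, v 0 = s ∧ v L = t ∧ ∀ k < L, 0 < n (v k, v (k + 1)) ∨ n (v (k + 1), v k) < 0) :
    ∃ L : ℕ, ∃ v : ℕ → V, v 0 = s ∧ v L = t ∧ (∀ k < L, 0 < n (v k, v (k + 1)) ∨ n (v (k + 1), v k) < 0) ∧
      ∀ i j, i ≤ L → j ≤ L → v i = v j → i = j := by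
  classical
  refine ⟨Nat.find h, ?_⟩
  obtain ⟨v, hv0, hvL, hv⟩ := Nat.find_spec h
  refine ⟨v, hv0, hvL, hv, fun i j hi hj hvij => ?_⟩
  by_contra hne
  rcases lt_or_gt_of_ne hne with hij | hij
  · obtain ⟨w, hw0, hwL, hw⟩ := posWalk_shorten hv0 hvL hv hij hj hvij
    have hmin := Nat.find_min' h (m := Nat.find h - (j - i)) ⟨w, hw0, hwL, hw⟩
    omega
  · obtain ⟨w, hw0, hwL, hw⟩ := posWalk_shorten hv0 hvL hv hij hi hvij.symm
    have hmin := Nat.find_min' h (m := Nat.find h - (i - j)) ⟨w, hw0, hwL, hw⟩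
    omega

/-! ### §3 The unit flow along a self-avoiding walk -/

omit [Fintype V] [DecidableEq V] in
/-- Distinct steps of a self-avoiding walk use distinct bonds. [cite: MadrasSlade1993, §1.2 (self-avoiding walks)] -/
private theorem sbond_injOn (r : V → ℕ) {L : ℕ} {v : ℕ → V} (hinj : ∀ i j, i ≤ L → j ≤ L → v i = v j → i = j)
    {k k' : ℕ} (hk : k < L) (hk' : k' < L) (h : sbond r v k = sbond r v k') : k = k' := by
  unfold sbond at h
  split_ifs at h with h1 h2 h2 <;> simp only [Prod.mk.injEq] at h
  · exact hinj k k' hk.le hk'.le h.1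
  · have e1 := hinj k (k' + 1) hk.le hk' h.1
    have e2 := hinj (k + 1) k' hk hk'.le h.2
    omega
  · have e1 := hinj (k + 1) k' hk hk'.le h.1
    have e2 := hinj k (k' + 1) hk.le hk' h.2
    omega
  · exact hinj k k' hk.le hk'.le h.2

omit [Fintype V] in
/-- The unit flow is `±1` on the bonds of the walk, with the sign of traversal. [folklore] -/
private theorem sflow_apply_sbond (r : V → ℕ) {L : ℕ} {v : ℕ → V}
    (hinj : ∀ i j, i ≤ L → j ≤ L → v i = v j → i = j) {k : ℕ} (hk : k < L) :
    sflow r L v (sbond r v k) = ssign r v k := by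
  unfold sflow
  rw [Finset.sum_eq_single k, if_pos rfl]
  · intro k' hk' hne
    exact if_neg fun h => hne (sbond_injOn r hinj hk (Finset.mem_range.1 hk') h).symm
  · intro hk'; exact absurd (Finset.mem_range.2 hk) hk'

omit [Fintype V] in
/-- The unit flow vanishes off the bonds of the walk. [folklore] -/
private theorem sflow_eq_zero (r : V → ℕ) {L : ℕ} {v : ℕ → V} {q : V × V} (hq : ∀ k < L, q ≠ sbond r v k) :
    sflow r L v q = 0 :=
  Finset.sum_eq_zero fun k hk => if_neg (hq k (Finset.mem_range.1 hk))

omit [Fintype V] in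
/-- The unit flow only depends on the first `L + 1` vertices. [folklore] -/
private theorem sflow_congr (r : V → ℕ) {L : ℕ} {v v' : ℕ → V} (h : ∀ i ≤ L, v' i = v i) :
    sflow r L v' = sflow r L v := by
  funext q
  unfold sflow sbond ssign
  refine Finset.sum_congr rfl fun k hk => ?_
  rw [Finset.mem_range] at hk
  rw [h k hk.le, h (k + 1) hk]

/-- **The unit flow along a walk `v 0 → v L` has divergence `δ_{v 0} − δ_{v L}`** (telescoping).
[cite: Lieb1980, p. 133 (directed graphs of the expansion)] -/
private theorem outflow_sflow (r : V → ℕ) (L : ℕ) (v : ℕ → V) (x : V) :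
    outflow (sflow r L v) x = (if x = v 0 then 1 else 0) - (if x = v L then 1 else 0) := by
  unfold outflow sflow
  calc ∑ p : V × V, (∑ k ∈ Finset.range L, if p = sbond r v k then ssign r v k else 0) *
          ((if x = p.1 then 1 else 0) - (if x = p.2 then 1 else 0))
      = ∑ k ∈ Finset.range L, ∑ p : V × V, (if p = sbond r v k then ssign r v k else 0) *
          ((if x = p.1 then 1 else 0) - (if x = p.2 then 1 else 0)) := by
        simp_rw [Finset.sum_mul]
        rw [Finset.sum_comm]
    _ = ∑ k ∈ Finset.range L,
          ssign r v k * ((if x = (sbond r v k).1 then 1 else 0) - (if x = (sbond r v k).2 then 1 else 0)) := by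
        refine Finset.sum_congr rfl fun k _ => ?_
        rw [Finset.sum_eq_single (sbond r v k), if_pos rfl]
        · intro p _ hp; rw [if_neg hp, zero_mul]
        · intro h; exact absurd (Finset.mem_univ _) h
    _ = ∑ k ∈ Finset.range L, ((if x = v k then (1 : ℤ) else 0) - (if x = v (k + 1) then 1 else 0)) := by
        refine Finset.sum_congr rfl fun k _ => ?_
        unfold ssign sbond
        by_cases h : r (v k) < r (v (k + 1))
        · simp only [if_pos h, one_mul]
        · simp only [if_neg h]
          ring
    _ = (if x = v 0 then 1 else 0) - (if x = v L then 1 else 0) :=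
        Finset.sum_range_sub' (fun k => if x = v k then (1 : ℤ) else 0) L

omit [Fintype V] [DecidableEq V] in
/-- Along an oriented current (`n_p ≠ 0 ⇒ r p.1 < r p.2`) a positive step traverses its bond with the sign of the
current: `σ_k · n(b_k) ≥ 1`. [cite: Lieb1980, p. 133 (directed graphs of the expansion)] -/
private theorem one_le_ssign_mul {r : V → ℕ} {n : V × V → ℤ} (hor : ∀ p, n p ≠ 0 → r p.1 < r p.2)
    {v : ℕ → V} {k : ℕ} (hk : 0 < n (v k, v (k + 1)) ∨ n (v (k + 1), v k) < 0) :
    1 ≤ ssign r v k * n (sbond r v k) := by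
  unfold ssign sbond
  by_cases h : r (v k) < r (v (k + 1))
  · rw [if_pos h, if_pos h]
    rcases hk with hk | hk
    · omega
    · exact absurd (hor (v (k + 1), v k) hk.ne) (not_lt.2 h.le)
  · rw [if_neg h, if_neg h]
    rcases hk with hk | hk
    · exact absurd (hor (v k, v (k + 1)) hk.ne') h
    · omega

omit [Fintype V] [DecidableEq V] in
/-- Removing the traversal sign lowers the magnitude by one. [folklore] -/
private theorem natAbs_sub_ssign {r : V → ℕ} {v : ℕ → V} {k : ℕ} {m : ℤ} (h : 1 ≤ ssign r v k * m) :
    (m - ssign r v k).natAbs + 1 = m.natAbs := by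
  unfold ssign at h ⊢
  split_ifs at h ⊢ <;> omega

omit [Fintype V] [DecidableEq V] in
/-- For couplings oriented along `r`, the merged coupling of a step is the coupling of its oriented bond.
[folklore] -/
private theorem coupling_sbond {J : V × V → ℝ} {r : V → ℕ} (hJor : ∀ p, J p ≠ 0 → r p.1 < r p.2)
    (v : ℕ → V) (k : ℕ) : J (sbond r v k) = J (v k, v (k + 1)) + J (v (k + 1), v k) := by
  unfold sbond
  by_cases h : r (v k) < r (v (k + 1))
  · rw [if_pos h]
    have h0 : J (v (k + 1), v k) = 0 := by
      by_contra hne; exact absurd (hJor _ hne) (not_lt.2 h.le)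
    rw [h0, add_zero]
  · rw [if_neg h]
    have h0 : J (v k, v (k + 1)) = 0 := by
      by_contra hne; exact h (hJor _ hne)
    rw [h0, zero_add]

/-! ### §4 Extraction: `W(n) ≤ (∏ u(K_b)) · W(n − f_ω)` -/

/-- **Path extraction with the Turán inequality.** For `J ≥ 0` oriented along `r`, a current `n` oriented along
`r`, and a self-avoiding positive walk `v 0, …, v L` of `n`:
`∏_p I_{n_p}(J_p) ≤ (∏_{k<L} u(K_{v_k v_{k+1}})) · ∏_p I_{(n − f)_p}(J_p)`, `f` the unit flow along the walk,
`u = I₁/I₀`, `K_{xy} = J(x,y) + J(y,x)`. [cite: Lieb1980, p. 133 (I_m(β) weights of the directed-graph expansion)] -/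
private theorem prod_besselI_le_extract {J : V × V → ℝ} (hJ : ∀ p, 0 ≤ J p) {r : V → ℕ}
    (hJor : ∀ p, J p ≠ 0 → r p.1 < r p.2) {n : V × V → ℤ} (hor : ∀ p, n p ≠ 0 → r p.1 < r p.2)
    {L : ℕ} {v : ℕ → V} (hv : ∀ k < L, 0 < n (v k, v (k + 1)) ∨ n (v (k + 1), v k) < 0)
    (hinj : ∀ i j, i ≤ L → j ≤ L → v i = v j → i = j) :
    ∏ p, besselI (n p) (J p) ≤
      (∏ k ∈ Finset.range L, besselI 1 (J (v k, v (k + 1)) + J (v (k + 1), v k)) /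
          besselI 0 (J (v k, v (k + 1)) + J (v (k + 1), v k))) *
        ∏ p, besselI ((n - sflow r L v) p) (J p) := by
  classical
  set B : Finset (V × V) := (Finset.range L).image (sbond r v) with hB
  set c : V × V → ℝ := fun p => if p ∈ B then besselI 1 (J p) / besselI 0 (J p) else 1 with hc
  -- pointwise comparison
  have hpt : ∀ p, besselI (n p) (J p) ≤ c p * besselI ((n - sflow r L v) p) (J p) := by
    intro p
    by_cases hp : p ∈ B
    · obtain ⟨k, hk, rfl⟩ := Finset.mem_image.1 hp
      rw [Finset.mem_range] at hk
      rw [hc]; dsimp only; rw [if_pos hp, Pi.sub_apply, sflow_apply_sbond r hinj hk]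
      exact besselI_le_besselRatio_mul (hJ _) (natAbs_sub_ssign (one_le_ssign_mul hor (hv k hk)))
    · have h0 : sflow r L v p = 0 :=
        sflow_eq_zero r fun k hk h => hp (Finset.mem_image.2 ⟨k, Finset.mem_range.2 hk, h.symm⟩)
      rw [hc]; dsimp only; rw [if_neg hp, one_mul, Pi.sub_apply, h0, sub_zero]
  have hprod : ∏ p, besselI (n p) (J p) ≤ ∏ p, c p * besselI ((n - sflow r L v) p) (J p) :=
    Finset.prod_le_prod (fun p _ => besselI_nonneg (hJ p) _) fun p _ => hpt p
  rw [Finset.prod_mul_distrib] at hprod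
  refine hprod.trans (mul_le_mul_of_nonneg_right (le_of_eq ?_) (prod_besselI_nonneg hJ _))
  -- `∏ c = ∏_{k<L} u(K_{v_k v_{k+1}})`
  rw [hc]
  dsimp only
  rw [Finset.prod_ite_mem, Finset.univ_inter, hB,
    Finset.prod_image fun k hk k' hk' h => sbond_injOn r hinj (Finset.mem_range.1 hk) (Finset.mem_range.1 hk') h]
  exact Finset.prod_congr rfl fun k _ => by rw [coupling_sbond hJor]

/-! ### §5 The constraint of the character expansion is the divergence condition -/

variable [MeasurableSpace Circle] [BorelSpace Circle]

omit [MeasurableSpace Circle] [BorelSpace Circle] in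
/-- **Valence criterion.** The term `n` of the character expansion of `∫ (∏_x θ_x^{k_x}) e^{∑ J cos}` survives iff
`div n = k`: `(∏ θ_x^{k_x}) ∏_p (θ̄_{p.1}θ_{p.2})^{n_p} ≡ 1 ⟺ ∀ x, ∑_p n_p([x = p.1] − [x = p.2]) = k_x`.
[cite: Lieb1980, p. 133 (subgraphs with prescribed valences)] -/
private theorem twistChar_pairChars_eq_one_iff (k : V → ℤ) (n : V × V → ℤ) :
    twistChar (pairChars V) (monomialChar k) n = 1 ↔ ∀ x, outflow n x = k x := by
  have hχ : (pairChars V) = fun p => monomialChar ((Pi.single p.2 (1 : ℤ) : V → ℤ) - Pi.single p.1 1) :=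
    funext fun p => by rw [pairChars_apply, diffChar_eq_monomialChar]
  rw [hχ, twistChar_monomialChar, monomialChar_eq_one_iff, funext_iff]
  simp only [Pi.add_apply, Finset.sum_apply, Pi.smul_apply, smul_eq_mul, Pi.sub_apply, Pi.single_apply,
    Pi.zero_apply]
  refine forall_congr' fun x => ?_
  have e : outflow n x =
      -∑ p : V × V, n p * ((if x = p.2 then (1 : ℤ) else 0) - (if x = p.1 then 1 else 0)) := by
    unfold outflow
    rw [← Finset.sum_neg_distrib]
    exact Finset.sum_congr rfl fun p _ => by ring
  rw [e]
  constructor <;> intro h <;> linarith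

omit [MeasurableSpace Circle] [BorelSpace Circle] in
/-- The partition-function constraint: `∏_p (θ̄_{p.1}θ_{p.2})^{n_p} ≡ 1 ⟺ div n = 0`.
[cite: Lieb1980, p. 133 (subgraphs with prescribed valences)] -/
private theorem twistChar_pairChars_one_eq_one_iff (n : V × V → ℤ) :
    twistChar (pairChars V) 1 n = 1 ↔ ∀ x, outflow n x = 0 := by
  have h := twistChar_pairChars_eq_one_iff (0 : V → ℤ) n
  rw [monomialChar_zero] at h
  simpa using h

/-! ### §6 Existence of the Mathlib walk with prescribed vertices -/

omit [Fintype V] [DecidableEq V] [MeasurableSpace Circle] [BorelSpace Circle] in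
/-- A vertex sequence with adjacent consecutive terms is the vertex sequence of a walk. [folklore] -/
private theorem exists_walk_getVert (G : SimpleGraph V) :
    ∀ (L : ℕ) (v : ℕ → V), (∀ k < L, G.Adj (v k) (v (k + 1))) →
      ∃ ω : G.Walk (v 0) (v L), ω.length = L ∧ ∀ i ≤ L, ω.getVert i = v i := by
  intro L
  induction L with
  | zero =>
    intro v _
    exact ⟨SimpleGraph.Walk.nil, rfl, fun i hi => by rw [Nat.le_zero.1 hi]; rfl⟩
  | succ L ih =>
    intro v hv
    obtain ⟨ω, hωL, hωv⟩ := ih (fun k => v (k + 1)) (fun k hk => hv (k + 1) (by omega))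
    refine ⟨SimpleGraph.Walk.cons (hv 0 (by omega)) ω, by rw [SimpleGraph.Walk.length_cons, hωL], fun i hi => ?_⟩
    cases i with
    | zero => rfl
    | succ i => rw [SimpleGraph.Walk.getVert_cons_succ]; exact hωv i (by omega)

/-! ### §7 The bound for oriented couplings -/

/-- **Fisher's bound, oriented form.** For `J ≥ 0` oriented along a ranking `r : V → ℕ` (`J_p ≠ 0 ⇒
r p.1 < r p.2`) and supported on the simple graph `G`:
`⟨cos(θ_a − θ_c)⟩_J ≤ ∑_{ω : G-path a → c} ∏_{k<|ω|} u(K_{ω_k ω_{k+1}})`.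
[cite: Fisher1967, Phys. Rev. 162 (1967) 480 (correlation ≤ self-avoiding-walk generating function); Lieb1980, p. 133 (directed-graph expansion)] -/
private theorem twoPoint_le_sum_paths_of_oriented {J : V × V → ℝ} (hJ : ∀ p, 0 ≤ J p) {r : V → ℕ}
    (hJor : ∀ p, J p ≠ 0 → r p.1 < r p.2) (G : SimpleGraph V) [DecidableRel G.Adj]
    (hG : ∀ p, J p ≠ 0 → G.Adj p.1 p.2) (a c : V) :
    twoPoint J a c ≤
      ∑ ω ∈ (G.finsetWalkLengthLT (Fintype.card V) a c).filter (fun ω => ω.IsPath),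
        ∏ k ∈ Finset.range ω.length,
          besselI 1 (J (ω.getVert k, ω.getVert (k + 1)) + J (ω.getVert (k + 1), ω.getVert k)) /
            besselI 0 (J (ω.getVert k, ω.getVert (k + 1)) + J (ω.getVert (k + 1), ω.getVert k)) := by
  classical
  -- notation
  set P := (G.finsetWalkLengthLT (Fintype.card V) a c).filter (fun ω => ω.IsPath) with hP
  set u : ℝ → ℝ := fun t => besselI 1 t / besselI 0 t
  set wt : G.Walk a c → ℝ := fun ω => ∏ k ∈ Finset.range ω.length,
    u (J (ω.getVert k, ω.getVert (k + 1)) + J (ω.getVert (k + 1), ω.getVert k)) with hwt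
  set W : (V × V → ℤ) → ℝ := fun n => ∏ p, besselI (n p) (J p)
  set C : (V × V → ℤ) → Prop := fun n => ∀ x, outflow n x = (if x = a then 1 else 0) - (if x = c then 1 else 0)
    with hC
  set C₀ : (V × V → ℤ) → Prop := fun n => ∀ x, outflow n x = 0
  set g : (V × V → ℤ) → ℝ := fun n => if C n then W n else 0 with hg
  set g₀ : (V × V → ℤ) → ℝ := fun n => if C₀ n then W n else 0 with hg₀
  set fl : G.Walk a c → (V × V → ℤ) := fun ω => sflow r ω.length ω.getVert with hfl
  show twoPoint J a c ≤ ∑ ω ∈ P, wt ω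
  -- basic signs
  have hu0 : ∀ t, 0 ≤ t → 0 ≤ u t := fun t ht => div_nonneg (besselI_nonneg ht 1) (besselI_nonneg ht 0)
  have hW0 : ∀ n, 0 ≤ W n := fun n => prod_besselI_nonneg hJ n
  have hwt0 : ∀ ω, 0 ≤ wt ω := fun ω =>
    Finset.prod_nonneg fun k _ => hu0 _ (add_nonneg (hJ _) (hJ _))
  have hg0' : ∀ n, 0 ≤ g₀ n := fun n => by
    simp only [hg₀]; split_ifs; exacts [hW0 n, le_rfl]
  have hg0le : ∀ n, g₀ n ≤ W n := fun n => by
    simp only [hg₀]; split_ifs; exacts [le_rfl, hW0 n]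
  have hgW : ∀ n, g n ≤ W n := fun n => by
    simp only [hg]; split_ifs; exacts [le_rfl, hW0 n]
  have hgnn : ∀ n, 0 ≤ g n := fun n => by
    simp only [hg]; split_ifs; exacts [hW0 n, le_rfl]
  -- summability of the Bessel weights
  have hWs : Summable W := by
    have h := summable_prod_norm (c := fun (p : V × V) (m : ℤ) => (besselI m (J p) : ℂ))
      fun p => summable_norm_coe_besselI (J p)
    exact h.congr fun n => Finset.prod_congr rfl fun p _ => Complex.norm_of_nonneg (besselI_nonneg (hJ p) _)
  have hgs : Summable g := Summable.of_nonneg_of_le hgnn hgW hWs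
  have hg₀s : Summable g₀ := Summable.of_nonneg_of_le hg0' hg0le hWs
  -- Step 1: the two-point function in the dual variables
  have hZ : 0 < ∫ θ, ginibreWeight (pairChars V) J θ ∂torusHaar V :=
    integral_exp_pos (integrable_of_continuous_compactSpace _ (continuous_ginibreWeight _ _))
  have hnum : ∫ θ, cosDiff c a θ * ginibreWeight (pairChars V) J θ ∂torusHaar V = ∑' n, g n := by
    simp_rw [cosDiff_eq_reChar]
    rw [integral_reChar_mul_ginibreWeight (torusHaar V) (pairChars V) J (diffChar c a)]
    refine tsum_congr fun n => ?_
    have hiff : twistChar (pairChars V) (diffChar c a) n = 1 ↔ C n := by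
      rw [diffChar_eq_monomialChar, twistChar_pairChars_eq_one_iff]
      simp only [hC, Pi.sub_apply, Pi.single_apply]
    by_cases hn : C n
    · rw [if_pos (hiff.2 hn)]
      show W n = g n
      rw [hg]; exact (if_pos hn).symm
    · rw [if_neg (fun h => hn (hiff.1 h))]
      show (0 : ℝ) = g n
      rw [hg]; exact (if_neg hn).symm
  have hden : ∫ θ, ginibreWeight (pairChars V) J θ ∂torusHaar V = ∑' n, g₀ n := by
    rw [integral_ginibreWeight_eq_tsum (torusHaar V) (pairChars V) J]
    refine tsum_congr fun n => ?_
    have hiff : twistChar (pairChars V) 1 n = 1 ↔ C₀ n := twistChar_pairChars_one_eq_one_iff n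
    by_cases hn : C₀ n
    · rw [if_pos (hiff.2 hn)]
      show W n = g₀ n
      rw [hg₀]; exact (if_pos hn).symm
    · rw [if_neg (fun h => hn (hiff.1 h))]
      show (0 : ℝ) = g₀ n
      rw [hg₀]; exact (if_neg hn).symm
  rw [twoPoint_comm, twoPoint, ginibreExpect, div_le_iff₀ hZ, hnum, hden]
  -- Step 2: pointwise domination `g n ≤ ∑_ω wt ω · g₀ (n − f_ω)`
  have hpt : ∀ n, g n ≤ ∑ ω ∈ P, wt ω * g₀ (n - fl ω) := by
    intro n
    have hrhs0 : 0 ≤ ∑ ω ∈ P, wt ω * g₀ (n - fl ω) :=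
      Finset.sum_nonneg fun ω _ => mul_nonneg (hwt0 ω) (hg0' _)
    by_cases hCn : C n
    swap
    · rw [hg]; dsimp only; rw [if_neg hCn]; exact hrhs0
    rw [hg]; dsimp only; rw [if_pos hCn]
    by_cases hWn : W n = 0
    · rw [hWn]; exact hrhs0
    -- the current is oriented and supported on `G`
    have hJn : ∀ p, n p ≠ 0 → J p ≠ 0 := fun p hp hJp => hWn (prod_besselI_eq_zero_of_ne hJp hp)
    have hor : ∀ p, n p ≠ 0 → r p.1 < r p.2 := fun p hp => hJor p (hJn p hp)
    -- a self-avoiding positive walk `a → c`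
    obtain ⟨L, v, hv0, hvL, hv, hinj⟩ := exists_injective_posWalk (exists_posWalk hCn)
    have hadj : ∀ k < L, G.Adj (v k) (v (k + 1)) := by
      intro k hk
      rcases hv k hk with h | h
      · exact hG (v k, v (k + 1)) (hJn _ h.ne')
      · exact (hG (v (k + 1), v k) (hJn _ h.ne)).symm
    obtain ⟨ω₀, hω₀L, hω₀v⟩ := exists_walk_getVert G L v hadj
    set ω : G.Walk a c := ω₀.copy hv0 hvL with hω
    have hωL : ω.length = L := by rw [hω, SimpleGraph.Walk.length_copy, hω₀L]
    have hωv : ∀ i ≤ L, ω.getVert i = v i := fun i hi => by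
      rw [hω, SimpleGraph.Walk.getVert_copy, hω₀v i hi]
    have hωP : ω ∈ P := by
      rw [hP, Finset.mem_filter]
      have hpath : ω.IsPath := by
        rw [← SimpleGraph.Walk.IsPath.getVert_injOn_iff]
        intro i hi j hj hij
        rw [Set.mem_setOf_eq, hωL] at hi hj
        rw [hωv i hi, hωv j hj] at hij
        exact hinj i j hi hj hij
      exact ⟨SimpleGraph.mem_finsetWalkLengthLT_iff.2 hpath.length_lt, hpath⟩
    have hflω : fl ω = sflow r L v := by
      rw [hfl]; dsimp only; rw [hωL]; exact sflow_congr r hωv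
    have hwtω : wt ω = ∏ k ∈ Finset.range L, u (J (v k, v (k + 1)) + J (v (k + 1), v k)) := by
      rw [hwt]; dsimp only; rw [hωL]
      refine Finset.prod_congr rfl fun k hk => ?_
      rw [Finset.mem_range] at hk
      rw [hωv k hk.le, hωv (k + 1) hk]
    -- the extracted current is divergence free
    have hC₀' : C₀ (n - fl ω) := by
      show ∀ x, outflow (n - fl ω) x = 0
      intro x
      rw [hflω, outflow_sub, outflow_sflow, hCn x, hv0, hvL, sub_self]
    -- extraction inequality
    have hex : W n ≤ wt ω * W (n - fl ω) := by
      rw [hwtω, hflω]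
      exact prod_besselI_le_extract hJ hJor hor hv hinj
    calc W n ≤ wt ω * g₀ (n - fl ω) := by rw [hg₀]; dsimp only; rw [if_pos hC₀']; exact hex
      _ ≤ ∑ ω' ∈ P, wt ω' * g₀ (n - fl ω') :=
          Finset.single_le_sum (f := fun ω' => wt ω' * g₀ (n - fl ω')) (fun ω' _ => mul_nonneg (hwt0 ω') (hg0' _)) hωP
  -- Step 3: summation; for a fixed walk the extraction is a translation of `ℤ^{V×V}`
  have htrans : ∀ ω : G.Walk a c, Summable fun n => wt ω * g₀ (n - fl ω) := fun ω =>
    (((Equiv.subRight (fl ω)).summable_iff.2 hg₀s).mul_left (wt ω))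
  have hshift : ∀ ω : G.Walk a c, ∑' n, wt ω * g₀ (n - fl ω) = wt ω * ∑' n, g₀ n := fun ω => by
    have h1 : ∑' n, g₀ (n - fl ω) = ∑' n, g₀ n := Equiv.tsum_eq (Equiv.subRight (fl ω)) g₀
    rw [tsum_mul_left, h1]
  calc ∑' n, g n ≤ ∑' n, ∑ ω ∈ P, wt ω * g₀ (n - fl ω) :=
        hgs.tsum_le_tsum hpt (summable_sum fun ω _ => htrans ω)
    _ = ∑ ω ∈ P, ∑' n, wt ω * g₀ (n - fl ω) := Summable.tsum_finsetSum fun ω _ => htrans ω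
    _ = ∑ ω ∈ P, wt ω * ∑' n, g₀ n := Finset.sum_congr rfl fun ω _ => hshift ω
    _ = (∑ ω ∈ P, wt ω) * ∑' n, g₀ n := by rw [Finset.sum_mul]

/-! ### §8 Fisher's bound for general pair couplings -/

/-- **Fisher's self-avoiding-walk bound for the plane rotator** (multigraph form of the memo's Theorem A, merged
per unordered bond). Let `J ≥ 0` be pair couplings on the ordered pairs of a finite vertex set `V` whose
off-diagonal support lies in the simple graph `G` (`x ≠ y`, `J(x,y) ≠ 0 ⇒ x ∼_G y`). Then for all `a, c ∈ V`
`⟨cos(θ_a − θ_c)⟩_J ≤ ∑_{ω} ∏_{k < |ω|} u(J(ω_k, ω_{k+1}) + J(ω_{k+1}, ω_k))`, `u = I₁/I₀`,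
the sum over the `G`-PATHS `ω : a → c` (self-avoiding walks; all of them have length `< |V|`). The Ising analogue
with `tanh β` per bond is Fisher (1967) (tree `isingTwoPoint_free_le_pathSum`); the weights `u(K)` are the two-spin
expectations of Lieb's Theorem 4 (summing the same weights over ALL walks instead of the self-avoiding ones would
return Lieb's criterion `∑_b u(K_{xb}) < 1`; that comparison is not re-derived here). [cite: Fisher1967, Phys. Rev. 162 (1967) 480 (correlation ≤ self-avoiding-walk generating function); Lieb1980, Theorem 4 and p. 133 (directed-graph expansion, I₁/I₀)] -/
theorem twoPoint_le_sum_paths_besselRatio {J : V × V → ℝ} (hJ : ∀ p, 0 ≤ J p) (G : SimpleGraph V)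
    [DecidableRel G.Adj] (hG : ∀ x y, x ≠ y → J (x, y) ≠ 0 → G.Adj x y) (a c : V) :
    twoPoint J a c ≤
      ∑ ω ∈ (G.finsetWalkLengthLT (Fintype.card V) a c).filter (fun ω => ω.IsPath),
        ∏ k ∈ Finset.range ω.length,
          besselI 1 (J (ω.getVert k, ω.getVert (k + 1)) + J (ω.getVert (k + 1), ω.getVert k)) /
            besselI 0 (J (ω.getVert k, ω.getVert (k + 1)) + J (ω.getVert (k + 1), ω.getVert k)) := by
  classical
  -- orient the couplings along an enumeration of `V`
  set r : V → ℕ := fun x => (Fintype.equivFin V x : ℕ)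
  have hrinj : Function.Injective r := fun x y h =>
    (Fintype.equivFin V).injective (Fin.ext h)
  set Jm : V × V → ℝ := fun p => if r p.1 < r p.2 then J p + J p.swap else 0 with hJm
  have hJm0 : ∀ p, 0 ≤ Jm p := fun p => by
    simp only [hJm]; split_ifs; exacts [add_nonneg (hJ _) (hJ _), le_rfl]
  have hJmor : ∀ p, Jm p ≠ 0 → r p.1 < r p.2 := fun p hp => by
    by_contra h
    exact hp (if_neg h)
  have hGm : ∀ p, Jm p ≠ 0 → G.Adj p.1 p.2 := by
    intro p hp
    have hlt := hJmor p hp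
    have hne : p.1 ≠ p.2 := fun h => hlt.ne (congrArg r h)
    have hp' : J p + J p.swap ≠ 0 := fun h0 => hp (by
      show (if r p.1 < r p.2 then J p + J p.swap else 0) = 0
      rw [if_pos hlt, h0])
    by_cases h1 : J p = 0
    · rw [h1, zero_add] at hp'
      exact (hG p.2 p.1 hne.symm hp').symm
    · exact hG p.1 p.2 hne h1
  -- the merged, oriented couplings have the same two-point functions
  have hsame : twoPoint J a c = twoPoint Jm a c := by
    set J₁ : V × V → ℝ := fun p => if p.1 = p.2 then 0 else J p with hJ₁
    have h1 : twoPoint J a c = twoPoint J₁ a c :=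
      twoPoint_congr_offDiag (fun p hp => by rw [hJ₁]; exact (if_neg hp).symm) a c
    rw [h1]
    refine twoPoint_eq_of_symm (fun p => ?_) a c
    simp only [hJ₁, hJm, Prod.fst_swap, Prod.snd_swap, Prod.swap_swap]
    rcases lt_trichotomy (r p.1) (r p.2) with h | h | h
    · have hne : p.1 ≠ p.2 := fun e => h.ne (congrArg r e)
      rw [if_neg hne, if_neg (Ne.symm hne), if_pos h, if_neg (not_lt.2 h.le), add_zero]
    · have he : p.1 = p.2 := hrinj h
      rw [if_pos he, if_pos he.symm, if_neg (by rw [h]; exact lt_irrefl _), if_neg (by rw [h]; exact lt_irrefl _)]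
    · have hne : p.1 ≠ p.2 := fun e => h.ne' (congrArg r e)
      rw [if_neg hne, if_neg (Ne.symm hne), if_neg (not_lt.2 h.le), if_pos h, zero_add, add_comm]
  -- merged couplings along the bonds of a path
  have hK : ∀ x y : V, x ≠ y → Jm (x, y) + Jm (y, x) = J (x, y) + J (y, x) := by
    intro x y hxy
    simp only [hJm, Prod.swap_prod_mk]
    rcases lt_trichotomy (r x) (r y) with h | h | h
    · rw [if_pos h, if_neg (not_lt.2 h.le), add_zero]
    · exact absurd (hrinj h) hxy
    · rw [if_neg (not_lt.2 h.le), if_pos h, zero_add, add_comm]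
  rw [hsame]
  refine (twoPoint_le_sum_paths_of_oriented hJm0 hJmor G hGm a c).trans (le_of_eq ?_)
  refine Finset.sum_congr rfl fun ω _ => Finset.prod_congr rfl fun k hk => ?_
  rw [Finset.mem_range] at hk
  rw [hK _ _ (ω.adj_getVert_succ hk).ne]

/-- **Uniform bond coupling: Fisher's bound with `u(K)^{|ω|}`.** If the merged coupling is the same number `K` on
every edge of `G` (`x ∼ y ⇒ J(x,y) + J(y,x) = K`; e.g. the tree's nearest-neighbour couplings `nnXYCoupling K d Λ`,
`K/2` per ordered pair), then `⟨cos(θ_a − θ_c)⟩_J ≤ ∑_{ω : G-path a → c} u(K)^{|ω|}`, `u = I₁/I₀` — the rotator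
analogue of `⟨σ_aσ_c⟩ ≤ ∑_ω tanh(β)^{|ω|}`. [cite: Fisher1967, Phys. Rev. 162 (1967) 480 (correlation ≤ self-avoiding-walk generating function); Lieb1980, Theorem 4 (I₁(β)/I₀(β) < 1/2ν)] -/
theorem twoPoint_le_sum_paths_pow_besselRatio {J : V × V → ℝ} (hJ : ∀ p, 0 ≤ J p) (G : SimpleGraph V)
    [DecidableRel G.Adj] (hG : ∀ x y, x ≠ y → J (x, y) ≠ 0 → G.Adj x y) {K : ℝ}
    (hK : ∀ x y, G.Adj x y → J (x, y) + J (y, x) = K) (a c : V) :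
    twoPoint J a c ≤
      ∑ ω ∈ (G.finsetWalkLengthLT (Fintype.card V) a c).filter (fun ω => ω.IsPath),
        (besselI 1 K / besselI 0 K) ^ ω.length := by
  refine (twoPoint_le_sum_paths_besselRatio hJ G hG a c).trans (le_of_eq (Finset.sum_congr rfl fun ω _ => ?_))
  have h : ∏ k ∈ Finset.range ω.length,
      besselI 1 (J (ω.getVert k, ω.getVert (k + 1)) + J (ω.getVert (k + 1), ω.getVert k)) /
        besselI 0 (J (ω.getVert k, ω.getVert (k + 1)) + J (ω.getVert (k + 1), ω.getVert k)) =
      ∏ _k ∈ Finset.range ω.length, besselI 1 K / besselI 0 K := by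
    refine Finset.prod_congr rfl fun k hk => ?_
    rw [Finset.mem_range] at hk
    rw [hK _ _ (ω.adj_getVert_succ hk)]
  rw [h, Finset.prod_const, Finset.card_range]

end Flow

end PlaneRotator

end Literature.Probability.LatticeModels

end
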